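import Summits.HubbardSuperconductivity.HubbardSuperconductivity.Theorems.WeakCouplingBCSKlLindhardEnclosureW20OfRules

/-!
# (22) Lindhard-enclosure instrument — the BOUNDARY-FLOOR rule predicate is FALSE AS TYPED at `P_W20`
# (negative lemma; tribunal T2-2 g22, located item «FLOOR-BDRY-ORIENTATION», KL STATUS l.11715)

Refuter file (D-0016 negative lane, `--supports stmt-HubbardSuperconductivity-0158`: the (22) instrument is a reader of the
certificate half `…Theses.WeakCouplingBCS.WcbcsKohnLuttingerB1g`).  No Theses decl is asserted or denied; only an
instrument-internal soundness predicate is shown unsatisfiable as typed.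

`FloorBdrySoundAt P` (✓ `…KlLindhardEnclosureFloorRules`) quantifies over ALL integer cells `(a b c d : ℤ)` with no
orientation prefix `a ≤ b → c ≤ d →` (unlike the three ORIENTED ceiling rules of record in `…CeilRulesOrd`).  On a cell whose
abscissa pair is REVERSED (`b < a`) the half-open box `P.cellSet a b c d` is EMPTY, so `P.cellIntBZ a b c d = 0`, while the
kernel's boundary-floor term can still be POSITIVE: `Params.cosDirZ u0 u1` certifies «`cos` decreasing on `[u0, u1]`» from
`u1 ≤ -piUpZ ∧ -2·piLoZ ≤ u0` (or `0 ≤ u0 ∧ u1 ≤ piLoZ`) without checking `u0 ≤ u1`, so for a reversed SHIFTED pair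
straddling `-π` the inner-cosine guard `aIn0 < aIn1` of `Params.floorBdry` passes.  WITNESS (found by a kernel `#eval` scan
of 33 792 reversed cells on a 32-grid: 17 468 match the single-straddle status pattern, 3 967 have `floorBdry > 0`):
`(a, b, c, d) = (-4718632, -5242924, -5767217, -5242924)`, `sh = true` (the straddler is `p + q`), `far = false`
(`p` certified EMPTY), hints `σx = 1540`, `σy = 4662`, value `floorBdry = 1853089 > 0 = 2^30 · cellIntBZ`.

CONSEQUENCES (kernel-checked below): (1) `IntegrableOn P_W20.integrand brillouinZone volume → ¬ FloorBdrySoundAt P_W20`;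
(2) since the three oriented ceiling rules give `CeilSoundAt P_W20 T_W20` and hence integrability
(`ceilSoundAt_of_three_rules`, `T_W20_eval`), the hypotheses of ✓ `W20_enclosure_of_five_rules` are JOINTLY UNSATISFIABLE as
typed — that capstone is vacuous until the floor predicates are ORIENTED.  REPAIR (the statement believed true, by precedent of
`…CeilStructuralOrd` / `…CeilRulesOrd`): prefix `P.admissible = true → P.InRoot a b c d → a ≤ b → c ≤ d →` on
`FloorInsideSoundAt` / `FloorBdrySoundAt` and re-thread `floorSoundAt_of_rules` through the oriented traversal; the witness
(`b < a`) misses the repaired statement.  CLASS: instrument-internal satisfiability («misstated» in the refuter's taxonomy); no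
landed theorem is false; no certificate number, record or DECIDED word moves; nothing here bears on `K₃`, `U₀`, the window or
superconductivity.  [folklore]
-/

set_option linter.dupNamespace false -- summit = problem name (single-conjunct summit), D-0017

namespace Summit.HubbardSuperconductivity.HubbardSuperconductivity.Theorems.KlLindhardEnclosure

open Real Set MeasureTheory Literature.MathematicalPhysics.QuantumLattice

/-- A cell with a reversed (or degenerate) abscissa pair carries no mass: its half-open box is empty. [folklore] -/
theorem Params.cellIntBZ_eq_zero_of_le (P : Params) (hU : 0 < P.U) {a b : ℤ} (h : b ≤ a) (c d : ℤ) :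
    P.cellIntBZ a b c d = 0 := by
  have hempty : P.cellSet a b c d ∩ brillouinZone = ∅ := by
    ext p
    simp only [Set.mem_inter_iff, Params.cellSet, Set.mem_setOf_eq, Set.mem_empty_iff_false, iff_false, not_and]
    intro h0 h1
    exfalso
    have hq : P.toQ b ≤ P.toQ a := by
      unfold Params.toQ
      exact div_le_div_of_nonneg_right (by exact_mod_cast h) (by exact_mod_cast hU.le)
    have hr : ((P.toQ b : ℚ) : ℝ) ≤ ((P.toQ a : ℚ) : ℝ) := by exact_mod_cast hq
    linarith
  unfold Params.cellIntBZ
  rw [hempty, Measure.restrict_empty, integral_zero_measure]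

/-- `U > 0` for the certificate parameters `P_W20`. [folklore] -/
theorem P_W20_U_pos : 0 < P_W20.U := by decide +kernel

/-- **The boundary-floor predicate is false as typed at `P_W20`, given integrability of the two-shell integrand**:
the reversed witness cell `x ∈ [-4718632, -5242924)` (EMPTY), `y ∈ [-5767217, -5242924)` satisfies every Boolean
hypothesis of `FloorBdrySoundAt P_W20` (`sh = true`, `far = false`, `σ = (1540, 4662)`) with a POSITIVE floor term. [folklore] -/
theorem floorBdrySoundAt_W20_false_of_integrable (hint : IntegrableOn P_W20.integrand brillouinZone volume) :
    ¬ FloorBdrySoundAt P_W20 := by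
  intro h
  have key := h (-4718632) (-5242924) (-5767217) (-5242924) true false 1540 4662
    (by decide +kernel) (by decide +kernel) (by decide +kernel) (by decide +kernel) hint
  rw [P_W20.cellIntBZ_eq_zero_of_le P_W20_U_pos (by decide) (-5767217) (-5242924), mul_zero] at key
  have hpos : (0 : ℝ) < ((P_W20.floorBdry (P_W20.cell (P_W20.mkX (-4718632)) (P_W20.mkX (-5242924))
      (P_W20.mkY (-5767217)) (P_W20.mkY (-5242924))) true (!false) 1540 4662 (P_W20.mkX (-4718632))
      (P_W20.mkX (-5242924)) (P_W20.mkY (-5767217)) (P_W20.mkY (-5242924)) : ℤ) : ℝ) := by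
    exact_mod_cast (show (0 : ℤ) < _ by decide +kernel)
  linarith

/-- **The rule predicates of record are jointly unsatisfiable at `P_W20` as typed**: the three ORIENTED ceiling rules yield
`CeilSoundAt P_W20 T_W20`, hence integrability of the integrand, which refutes the UN-oriented boundary-floor rule. [folklore] -/
theorem W20_floorBdry_ceilRules_inconsistent :
    ¬ (FloorBdrySoundAt P_W20 ∧ CeilChordSoundOrd P_W20 ∧ CeilBdrySoundOrd P_W20 ∧ CeilTipSoundOrd P_W20) := by
  rintro ⟨hB, hCh, hBd, hT⟩
  have hC := ceilSoundAt_of_three_rules P_W20 hCh hBd hT T_W20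
  have hint := (hC 14677221910 P_W20_admissible (by rw [T_W20_eval])).1
  exact floorBdrySoundAt_W20_false_of_integrable hint hB

/-- Corollary: the five hypotheses of `W20_enclosure_of_five_rules` cannot all hold as typed. [folklore] -/
theorem W20_five_rules_unsatisfiable :
    ¬ (FloorInsideSoundAt P_W20 ∧ FloorBdrySoundAt P_W20 ∧ CeilChordSoundOrd P_W20 ∧ CeilBdrySoundOrd P_W20 ∧
      CeilTipSoundOrd P_W20) :=
  fun h => W20_floorBdry_ceilRules_inconsistent h.2

end Summit.HubbardSuperconductivity.HubbardSuperconductivity.Theorems.KlLindhardEnclosure
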